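import Mathlib
import HarnessLib
import Summits.QuantumFields.YangMills.Theses.PencilRigidity
import Summits.QuantumFields.YangMills.Theses.CoincidenceRotationBootstrap
import Summits.QuantumFields.YangMills.Theses.MirrorModularBoosts
import Summits.QuantumFields.YangMills.Theorems.HypercubicLimit.Negative.OneFieldReduction
import Summits.QuantumFields.YangMills.Theorems.HypercubicLimit.Negative.AllTimesGapFalse
import Summits.QuantumFields.YangMills.Theorems.HypercubicLimit.Negative.NonTrivialityBridge
import Summits.QuantumFields.YangMills.Theorems.HypercubicLimit.Negative.NonabelianLoadBearing
import Literature.MathematicalPhysics.QuantumFieldTheory.YangMillsOS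
import Literature.MathematicalPhysics.QuantumLattice.LatticeGaugeDLR

/-!
# Line `conditional-mean-telescoping` for crux `HypercubicLimit` (stmt-QuantumFields-8646)

Skeleton of the line (crux-plan, 2026-08-16; gen-2 revision 2026-08-16T00:19Z: imports the landed one-field
reduction instead of vendoring it).  LEAD'S RESHAPE 2 (prover-line-stmt-QuantumFields-8646-0, 2026-08-16):
the seven registered stubs are now `stub_condMeanLocality` (Markov property of the torus Wilson
state — NEW, provable now, tree vocabulary only), `stub_telescoping` (locality ⇒ (T) ∧ (M), tree
vocabulary only), `stub_latticeGapInput`, `stub_influenceWindow` (= (WI₂) ∧ (WIₙ), merged, the lead's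
bet), `stub_windowRegularity`, `stub_nonGaussianFloor`, `stub_closure`; the influence profile carries
its base site (no translation invariance anywhere in the line); the two tree-vocabulary stubs contain
no `:=` so the registry records their full signatures and their landings are pure proof files
(`telescoping_of_stubs` checks they are definitionally `TelescopingBound ∧ InfluenceAntitone`).
Seven registered stubs `stub_*` (sorried, each a
lemma of the line), the kernel-checked composition `HypercubicLimit_of` (no `sorry` of its own),
whose conclusion is literally `Summit.QuantumFields.YangMills.Theses.PencilRigidity.HypercubicLimit`,
and the registered target `HypercubicLimit_proof : …CoincidenceRotationBootstrap.HypercubicLimit`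
(the item's primary route; the three routes' copies of the decl are definitionally equal).

The lever (idea card `Ideas/conditional-mean-telescoping.md`): for plaquette sites pairwise more
than `2R+1` apart, the torus `n`-point function of centred plaquettes EQUALS the expectation of the
product of their CONDITIONAL MEANS given the exteriors of radius-`R` cubes (tower + nearest-
neighbour Markov property), hence is bounded by a product of `Lⁿ` INFLUENCE NORMS of one
plaquette and one cube (`stub_telescoping`, provable now, with exact antitonicity in `R`).  Two
scale-free inequalities BELOW a fixed fraction `c₀` of the correlation length carry E0′ of the
renormalised curvature field across the crossover: the `L²` influence of the 8 faces of a cube is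
at most a constant times the half-space anchor `√⟨θX·X⟩` (`stub_cornerFreeInfluence`), and the
`Lⁿ/L²` ratio grows polynomially in `n` (`stub_influenceReverseHolder`, the load-bearing bet);
plus polynomial doubling / cone comparability / a polynomial floor of the reference RP square
(`stub_windowRegularity`).  The IR half is IMPORTED (`stub_latticeGapInput`, 8901-shape lattice gap
with `ξ → ∞`, stated in the RP-spectral form the closure actually consumes); non-Gaussianity is a
scale-free smeared `κ₃` floor (`stub_nonGaussianFloor`, socket for `running-pole-skewness`); the
closure (`stub_closure`) is compactness + OS inheritance + gap transfer + RP normalisation and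
concludes the ONE-FIELD form of the crux, which implies the crux by the standing disprover's
one-field reduction, LANDED as `Theorems/HypercubicLimit/Negative/OneFieldReduction.lean`
(`hypercubicLimit_iff_oneField`; imported — gen 2, nothing vendored).  The crux's other landed
Negative lemmas (`AllTimesGapFalse`, `NonTrivialityBridge`, `NonabelianLoadBearing`) are imported
too, so the stubs are checked in their presence: none is an instance they refute (every clause
keeps `n ≤ S`-type side conditions — `not_hasLatticeMassGapAllTimes`; non-abelianness enters only
through `LatticeGapInput` — `hypercubicLimit_false_without_nonabelian`).

Primitive observable: ONE plaquette `Re tr ρ(U_p)` of orientation `(i, j)` (all orientations have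
the same influence profile by hypercubic symmetry; the closure expands the action density
`r.curvature = ∑_{i<j} p_{ij}` multilinearly).  Reference two-point quantity: the RP SQUARE
`rpSquare r β S R = ⟨θX · X⟩`, `X = δp₀₁` based at time `R`, `θ = GaugeConfig.timeReflect`
(`t ↦ 1 - t`) — manifestly a reflection-positivity square (triage r1-1 sharpening).
-/

noncomputable section

open scoped SchwartzMap ENNReal
open MeasureTheory Filter Topology
open Literature.MathematicalPhysics.AQFT Literature.MathematicalPhysics.QuantumLattice
open Literature.MathematicalPhysics.QuantumFieldTheory

namespace Summit.QuantumFields.YangMills.Cruxes.HypercubicLimit.ConditionalMeanTelescoping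

local notation "E4" => EuclideanSpace ℝ (Fin 4)
local notation "Zd4" => Literature.Probability.LatticeModels.Site 4
local notation "ZdEdge4" => Literature.MathematicalPhysics.QuantumLattice.ZdEdge 4

/-! ## 0. Objects: one plaquette, its cube-exterior influence, its RP square -/

section Objects

variable {G : Type} [Group G] [TopologicalSpace G] [IsTopologicalGroup G] [CompactSpace G]
  [MeasurableSpace G] [BorelSpace G]

/-- Edges of `ℤ⁴` interior to the `ℓ^∞`-cube of radius `R` about `x` (both endpoints inside). -/
def cubeEdges (R : ℕ) (x : Zd4) : Set ZdEdge4 :=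
  {e | (∀ μ, |e.1 μ - x μ| ≤ R) ∧ ∀ μ, |e.1 μ + (if μ = e.2 then 1 else 0) - x μ| ≤ R}

/-- Their images on the torus of side `L` (the cube must fit: `2R + 2 ≤ L`). -/
def cubeEdgesT (L R : ℕ) (x : Zd4) : Set (Edge 4 L) :=
  torusEdge L '' cubeEdges R x

/-- The **exterior σ-algebra** of the cube `Q_R(x)`: cylinder events of the torus links NOT
interior to the cube (Mathlib `cylinderEvents`). -/
@[reducible] def exterior (L R : ℕ) (x : Zd4) : MeasurableSpace (GaugeConfig 4 L G) :=
  cylinderEvents (X := fun _ : Edge 4 L => G) (cubeEdgesT L R x)ᶜ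

/-- The single plaquette observable `Re tr ρ(U_p)` of orientation `(i, j)` based at the
`ℤ⁴`-site `x`, on the torus of side `L` (periodic lift). -/
def torusPlaquette (r : LatticeRep G) (L : ℕ) (i j : Fin 4) (x : Zd4) (U : GaugeConfig 4 L G) : ℝ :=
  plaquetteObs r.ρ x i j (torusLift L U)

/-- The curvature species (Wilson action density, six plaquettes) at the `ℤ⁴`-site `x` on the
torus of side `L`, with EXACTLY the translation convention of `smearedLatticeField`. -/
def torusDensity (r : LatticeRep G) (L : ℕ) (x : Zd4) (U : GaugeConfig 4 L G) : ℝ :=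
  r.curvature.F (configShift (-x) (torusLift L U))

/-- **Influence profile** (real-valued) `I_p^{(ij)}(β, S, R; x) :=
‖ E_{β,S}[ p_{ij}(x) − ⟨p_{ij}(x)⟩ | exterior of Q_R(x) ] ‖_{Lᵖ(μ_{β,S})}` on the symmetric torus
of side `2S+1` — ONE plaquette, ONE cube, based at the `ℤ⁴`-site `x` (lead's reshape 2: the base
site is a parameter, so that no stub and no glue needs the translation invariance of the torus
state — the closure consumes only the site-free right-hand side of `GaussianDomination`). -/
def influence (r : LatticeRep G) (β : ℝ) (S R : ℕ) (x : Zd4) (i j : Fin 4) (p : ℝ≥0∞) : ℝ :=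
  let μ := wilsonMeasure (d := 4) (L := 2 * S + 1) r.ρ β
  let X : GaugeConfig 4 (2 * S + 1) G → ℝ :=
    fun U => torusPlaquette r (2 * S + 1) i j x U - ∫ V, torusPlaquette r (2 * S + 1) i j x V ∂μ
  (eLpNorm (μ[X | exterior (2 * S + 1) R x]) p μ).toReal

/-- **Reference RP square** `A(β, S, R) := ⟨θX · X⟩_{β,S}`, `X = p₀₁(R e₀) − ⟨p₀₁⟩`,
`θ = GaugeConfig.timeReflect` (`t ↦ 1 − t`): the reflection-positivity square of ONE plaquette at
height `R` above the reflection hyperplane (reflected separation `2R − 1`); `= ‖E[X | lower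
half]‖₂²` in infinite volume (the half-space anchor of the card). -/
def rpSquare (r : LatticeRep G) (β : ℝ) (S R : ℕ) : ℝ :=
  let μ := wilsonMeasure (d := 4) (L := 2 * S + 1) r.ρ β
  let X : GaugeConfig 4 (2 * S + 1) G → ℝ :=
    fun U => torusPlaquette r (2 * S + 1) 0 1 (Pi.single 0 (R : ℤ)) U -
      ∫ V, torusPlaquette r (2 * S + 1) 0 1 (Pi.single 0 (R : ℤ)) V ∂μ
  ∫ U, X (GaugeConfig.timeReflect U) * X U ∂μ

/-- Reflected-pair two-point function of the ACTION DENSITY: `Cov(P_x ∘ θ, P_y)` on the torus of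
side `2S+1` (the summand of the lattice RP square of a smeared curvature field; `P ∘ θ` is the
action density with its temporal plaquettes hanging downward from `θx`). -/
def reflPair (r : LatticeRep G) (β : ℝ) (S : ℕ) (x y : Zd4) : ℝ :=
  let μ := wilsonMeasure (d := 4) (L := 2 * S + 1) r.ρ β
  (∫ U, torusDensity r (2 * S + 1) x (GaugeConfig.timeReflect U) * torusDensity r (2 * S + 1) y U ∂μ) -
    (∫ U, torusDensity r (2 * S + 1) x (GaugeConfig.timeReflect U) ∂μ) *
      ∫ U, torusDensity r (2 * S + 1) y U ∂μ

/-- Smeared connected three-point function of the centred action density at lattice spacing `a`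
(Riemann normalisation `a¹² = (a⁴)³`, no multiplicative renormalisation): the `κ₃` the closure
renormalises by `c_k³`. -/
def smearedThreePoint (r : LatticeRep G) (β : ℝ) (S : ℕ) (a : ℝ) (φ₁ φ₂ φ₃ : 𝓢(E4, ℝ)) : ℝ :=
  let μ := wilsonMeasure (d := 4) (L := 2 * S + 1) r.ρ β
  let δP : Zd4 → GaugeConfig 4 (2 * S + 1) G → ℝ :=
    fun x U => torusDensity r (2 * S + 1) x U - ∫ V, torusDensity r (2 * S + 1) x V ∂μ
  a ^ 12 * ∑ x ∈ Literature.Probability.LatticeModels.box 4 S,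
    ∑ y ∈ Literature.Probability.LatticeModels.box 4 S,
      ∑ z ∈ Literature.Probability.LatticeModels.box 4 S,
        φ₁ (a • siteToE x) * φ₂ (a • siteToE y) * φ₃ (a • siteToE z) *
          ∫ U, δP x U * δP y U * δP z U ∂μ

end Objects

/-! ## 1. (T)+(M) Telescoping bound and exact antitonicity — provable now -/

/-- **(T) Wilson-torus telescoping bound.** For plaquettes of orientations `o k` at `ℤ⁴` base
points `x k` pairwise more than `2R+1` apart in `ℓ^∞` (and at most `S`, no torus aliasing:
`4R+4 < 2S+1`), the torus `n`-point function of the centred plaquettes is bounded by the product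
of the `Lⁿ` influence norms: tower property + pull-out (`condExp_mul_of_stronglyMeasurable_left`,
shell-measurability of the conditional mean as an a.e.-EQUAL version — triage r1-2 note 2) +
DLR/Markov property of the torus Wilson specification (`isSpecification_ymSpecification_t2`) +
generalised Hölder (no translation invariance needed: the influences are taken at the base
points `x k`). -/
def TelescopingBound : Prop :=
  ∀ (G : Type) [Group G] [TopologicalSpace G] [IsTopologicalGroup G] [CompactSpace G]
    [MeasurableSpace G] [BorelSpace G] (r : LatticeRep G) (β : ℝ) (S R n : ℕ)
    (o : Fin n → Fin 4 × Fin 4) (x : Fin n → Zd4),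
    (∀ k, (o k).1 ≠ (o k).2) →
    4 * R + 4 < 2 * S + 1 →
    (∀ k l, k ≠ l → ∃ μ : Fin 4, (2 * R + 1 : ℤ) < |x k μ - x l μ| ∧ |x k μ - x l μ| ≤ S) →
      let μ := wilsonMeasure (d := 4) (L := 2 * S + 1) r.ρ β
      |∫ U, ∏ k, (torusPlaquette r (2 * S + 1) (o k).1 (o k).2 (x k) U -
          ∫ V, torusPlaquette r (2 * S + 1) (o k).1 (o k).2 (x k) V ∂μ) ∂μ|
        ≤ ∏ k, influence r β S R (x k) (o k).1 (o k).2 n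

/-- **(M) Exact antitonicity of the influence profile in the cube radius** (`1 ≤ p`):
`Q_{R'} ⊆ Q_R ⇒ exterior(R) ≤ exterior(R')`, tower property and `Lᵖ`-contractivity of conditional
expectation (`eLpNorm_condExp_le_eLpNorm`); finiteness from boundedness of the plaquette. -/
def InfluenceAntitone : Prop :=
  ∀ (G : Type) [Group G] [TopologicalSpace G] [IsTopologicalGroup G] [CompactSpace G]
    [MeasurableSpace G] [BorelSpace G] (r : LatticeRep G) (β : ℝ) (S : ℕ) (x : Zd4) (i j : Fin 4)
    (p : ℝ≥0∞), 1 ≤ p → ∀ R R' : ℕ, R' ≤ R → 2 * R + 2 < 2 * S + 1 →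
      influence r β S R x i j p ≤ influence r β S R' x i j p

/-! ## 2. (L′) The imported IR input: one-scale lattice gap with `ξ → ∞` -/

/-- **Gap data** for `(G, r)`: a rate function `m` on `[β₁, ∞)` with
(i) `0 < m(β)`, `m(β) → 0` (`ξ → ∞`);
(ii) 8901-shape ALL-PAIRS volume-uniform decay of connected time-correlations at rate `m(β)`
(per-pair constants; feeds `HasLatticeMassGap` verbatim with `a_k := m(β_k)`, `Δ = 1`);
(iii) RP-SPECTRAL relative clustering of centred slab functionals with thermal error `ε(S) → 0`
(what a transfer-matrix gap `spec T ⊆ {1} ∪ [0, e^{-m}]` gives on large tori; scale-free, so it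
survives multiplicative renormalisation — feeds `HasMassGap`/E4 of the continuum limit);
(iv) axial comparability: beyond `c₂/m(β)` (and below a quarter of the torus, where thermal
images are negligible) the reference RP square decays per unit height by at most `e^{-C₁ m(β)}`
(pins admissible `m` to the plaquette's own mass, `m_P ≤ C₁ m`). -/
def GapData (G : Type) [Group G] [TopologicalSpace G] [IsTopologicalGroup G] [CompactSpace G]
    [MeasurableSpace G] [BorelSpace G] (r : LatticeRep G) (β₁ C₁ c₂ : ℝ) (m : ℝ → ℝ) : Prop :=
  (∀ β : ℝ, β₁ ≤ β → 0 < m β) ∧ Tendsto m atTop (𝓝 0) ∧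
  (∀ A B : YMSpecies G, ∃ (C : ℝ) (S₀ : ℕ), ∀ β : ℝ, β₁ ≤ β → ∀ S : ℕ, S₀ ≤ S → ∀ n : ℕ, n ≤ S →
      |latticeConnectedCorr r.ρ β (2 * S + 1) A.F B.F n| ≤ C * Real.exp (-(m β * n))) ∧
  (∀ β : ℝ, β₁ ≤ β → ∃ ε : ℕ → ℝ, Tendsto ε atTop (𝓝 0) ∧
      ∀ (S T n : ℕ), 2 * (T + n + 1) ≤ S →
        ∀ (Y : LGConfig 4 G → ℝ) (B : ℝ), Measurable Y → (∀ U, |Y U| ≤ B) →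
          DependsOn Y {e : ZdEdge4 | 1 ≤ e.1 0 ∧ e.1 0 + (if e.2 = 0 then 1 else 0) ≤ T} →
            let μ := wilsonMeasure (d := 4) (L := 2 * S + 1) r.ρ β
            |(∫ U, Y (torusLift (2 * S + 1) (GaugeConfig.timeReflect U)) *
                  Y (configShift (-Pi.single 0 (n : ℤ)) (torusLift (2 * S + 1) U)) ∂μ) -
                (∫ U, Y (torusLift (2 * S + 1) U) ∂μ) ^ 2|
              ≤ Real.exp (-(m β * n)) *
                  ((∫ U, Y (torusLift (2 * S + 1) (GaugeConfig.timeReflect U)) *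
                      Y (torusLift (2 * S + 1) U) ∂μ) -
                    (∫ U, Y (torusLift (2 * S + 1) U) ∂μ) ^ 2) +
                ε S * B ^ 2) ∧
  (∀ β : ℝ, β₁ ≤ β → ∃ S₀ : ℕ, ∀ S : ℕ, S₀ ≤ S → ∀ n : ℕ, c₂ / m β ≤ n → 4 * n + 8 ≤ S →
      Real.exp (-(C₁ * m β)) * rpSquare r β S n ≤ rpSquare r β S (n + 1))

/-- **(L′) Lattice gap input** (imported IR open problem, shared with
`ModularSelfDualFold.WeakCouplingLatticeGap` 8901 / `XiCompleteMonotonicity.XiDiverges` 8941):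
every compact simple `G` has a faithful `r` and gap data. -/
def LatticeGapInput : Prop :=
  ∀ (G : Type) [Group G] [TopologicalSpace G] [IsTopologicalGroup G] [CompactSpace G]
    [MeasurableSpace G] [BorelSpace G], IsCompactSimpleLieGroup G →
    ∃ (r : LatticeRep G) (β₁ C₁ c₂ : ℝ) (m : ℝ → ℝ), GapData G r β₁ C₁ c₂ m

/-! ## 3. The window cruxes (ONE plaquette, below every fixed fraction of the correlation length) -/

/-- **(WI₂) Corner-free influence** (the `n = 2` content, kit-checkable two-level estimator):
below `c₀/m(β)` the `L²` influence of the EXTERIOR OF A CUBE of radius `R` on a plaquette at its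
centre is at most `C(c₀)` times the square root of the reference RP square at height `R` (the
exact `L²` influence of ONE half-space at that distance): the 8 faces cost a constant.  Stated at
every base site `x` with site-independent constants (reshape 2; equivalent to the origin version
by translation invariance of the torus state, which thereby disappears from the line). -/
def CornerFreeInfluence : Prop :=
  ∀ (G : Type) [Group G] [TopologicalSpace G] [IsTopologicalGroup G] [CompactSpace G]
    [MeasurableSpace G] [BorelSpace G], IsCompactSimpleLieGroup G →
    ∀ (r : LatticeRep G) (β₁ C₁ c₂ : ℝ) (m : ℝ → ℝ), GapData G r β₁ C₁ c₂ m →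
      ∀ c₀ : ℝ, 0 < c₀ → ∃ (C β₀ : ℝ), ∀ β : ℝ, β₀ ≤ β → ∃ S₀ : ℕ, ∀ S : ℕ, S₀ ≤ S →
        ∀ R : ℕ, 1 ≤ R → (R : ℝ) ≤ c₀ / m β → ∀ (x : Zd4) (i j : Fin 4), i ≠ j →
          influence r β S R x i j 2 ≤ C * Real.sqrt (rpSquare r β S R)

/-- **(WIₙ) Influence reverse Hölder / hypercontractivity** (rank 2 of the line, the bet): below
`c₀/m(β)` the `Lⁿ` influence is at most `C(c₀) n^γ` times the `L²` influence, for EVERY `n ≥ 2`,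
uniformly in `β` and in the volume (`γ` explicit and polynomial; an `L^∞` version is FALSE —
large-field shells, triage r1-2).  Spectrally a bound on excited-state form factors of the plaquette
by vacuum overlaps; Gaussian value `γ = 1` (order-2 chaos).  Every base site `x`,
site-independent constants (reshape 2). -/
def InfluenceReverseHolder : Prop :=
  ∀ (G : Type) [Group G] [TopologicalSpace G] [IsTopologicalGroup G] [CompactSpace G]
    [MeasurableSpace G] [BorelSpace G], IsCompactSimpleLieGroup G →
    ∀ (r : LatticeRep G) (β₁ C₁ c₂ : ℝ) (m : ℝ → ℝ), GapData G r β₁ C₁ c₂ m →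
      ∀ c₀ : ℝ, 0 < c₀ → ∃ (C β₀ : ℝ) (γ : ℕ), ∀ β : ℝ, β₀ ≤ β → ∀ n : ℕ, 2 ≤ n →
        ∃ S₀ : ℕ, ∀ S : ℕ, S₀ ≤ S → ∀ R : ℕ, 1 ≤ R → (R : ℝ) ≤ c₀ / m β →
          ∀ (x : Zd4) (i j : Fin 4), i ≠ j →
            influence r β S R x i j n ≤ C * (n : ℝ) ^ γ * influence r β S R x i j 2

/-- **(W2) Window regularity of the reference RP square** (rank 3 of the line):
(a) bounded effective exponent — polynomial doubling `A(R) ≤ C (R'/R)^p A(R')` for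
`1 ≤ R ≤ R' ≤ c₀/m(β)` (no exponential regime between the lattice scale and the gap);
(b) reflected-pair cone comparability — for sites `x, y` at heights in `[R, (1+θ)R]` and transverse
offset `≤ θR`, `Cov(P_x ∘ θ, P_y) ≥ c · A(R)` for the ACTION DENSITY `P` (turns the axial anchor into
a smeared reflection-positive normalisation, making `IsNontrivial` automatic);
(c) polynomial floor `A(β, S, 1) ≥ m(β)^q` (the renormalisation constant is polynomial in `1/a_k`). -/
def WindowRegularity : Prop :=
  ∀ (G : Type) [Group G] [TopologicalSpace G] [IsTopologicalGroup G] [CompactSpace G]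
    [MeasurableSpace G] [BorelSpace G], IsCompactSimpleLieGroup G →
    ∀ (r : LatticeRep G) (β₁ C₁ c₂ : ℝ) (m : ℝ → ℝ), GapData G r β₁ C₁ c₂ m →
      ∀ c₀ : ℝ, 0 < c₀ → ∃ (C c θ β₀ : ℝ) (p q : ℕ), 0 < c ∧ 0 < θ ∧
        ∀ β : ℝ, β₀ ≤ β → ∃ S₀ : ℕ, ∀ S : ℕ, S₀ ≤ S →
          (∀ R R' : ℕ, 1 ≤ R → R ≤ R' → (R' : ℝ) ≤ c₀ / m β →
              rpSquare r β S R ≤ C * ((R' : ℝ) / R) ^ p * rpSquare r β S R') ∧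
          (∀ (R : ℕ) (x y : Zd4), 1 ≤ R → (R : ℝ) ≤ c₀ / m β →
              (R : ℝ) ≤ x 0 → (x 0 : ℝ) ≤ (1 + θ) * R → (R : ℝ) ≤ y 0 → (y 0 : ℝ) ≤ (1 + θ) * R →
              (∀ i : Fin 4, i ≠ 0 → (|x i - y i| : ℝ) ≤ θ * R) →
                c * rpSquare r β S R ≤ reflPair r β S x y) ∧
          m β ^ q ≤ rpSquare r β S 1

/-! ## 4. (NG) The non-Gaussianity socket -/

/-- **(NG) Scale-free smeared `κ₃` floor** (socket; suppliers: `running-pole-skewness` via the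
`β`-derivative identity at scale `ξ`, or an NLO window witness): at SOME physical scale `s₁`, for
three fixed Schwartz bumps with pairwise disjoint supports in the ball of radius `s₁`, the smeared
connected three-point function of the action density at lattice spacing `m(β)` has a definite
sign and is at least `c₁ A(⌊s₁/m(β)⌋)^{3/2}` in size, for `β ≥ β₀` on large tori. -/
def NonGaussianFloor : Prop :=
  ∀ (G : Type) [Group G] [TopologicalSpace G] [IsTopologicalGroup G] [CompactSpace G]
    [MeasurableSpace G] [BorelSpace G], IsCompactSimpleLieGroup G →
    ∀ (r : LatticeRep G) (β₁ C₁ c₂ : ℝ) (m : ℝ → ℝ), GapData G r β₁ C₁ c₂ m →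
      ∃ (s₁ σ c₁ β₀ : ℝ) (φ₁ φ₂ φ₃ : 𝓢(E4, ℝ)), 0 < s₁ ∧ (σ = 1 ∨ σ = -1) ∧ 0 < c₁ ∧
        tsupport φ₁ ⊆ Metric.ball 0 s₁ ∧ tsupport φ₂ ⊆ Metric.ball 0 s₁ ∧
        tsupport φ₃ ⊆ Metric.ball 0 s₁ ∧
        Disjoint (tsupport φ₁) (tsupport φ₂) ∧ Disjoint (tsupport φ₁) (tsupport φ₃) ∧
        Disjoint (tsupport φ₂) (tsupport φ₃) ∧
        ∀ β : ℝ, β₀ ≤ β → ∃ S₀ : ℕ, ∀ S : ℕ, S₀ ≤ S →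
          c₁ * Real.sqrt (rpSquare r β S ⌊s₁ / m β⌋₊) ^ 3 ≤
            σ * smearedThreePoint r β S (m β) φ₁ φ₂ φ₃

/-! ## 5. Gaussian domination of separated moments (derived; the glue is proved below) -/

/-- **Gaussian domination of separated moments** (consequence of (T), (M), (WI₂), (WIₙ)): for
plaquettes pairwise more than `2R+1` apart and ANY window radius `1 ≤ R' ≤ min(R, c₀/m(β))`, the
torus `n`-point function of the centred plaquettes is at most `(C n^γ √A(R'))ⁿ` — the separated
`n`-point function is dominated by the `(n/2)`-th power of a TWO-point quantity. -/
def GaussianDomination : Prop :=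
  ∀ (G : Type) [Group G] [TopologicalSpace G] [IsTopologicalGroup G] [CompactSpace G]
    [MeasurableSpace G] [BorelSpace G], IsCompactSimpleLieGroup G →
    ∀ (r : LatticeRep G) (β₁ C₁ c₂ : ℝ) (m : ℝ → ℝ), GapData G r β₁ C₁ c₂ m →
      ∀ c₀ : ℝ, 0 < c₀ → ∃ (C β₀ : ℝ) (γ : ℕ), ∀ β : ℝ, β₀ ≤ β → ∀ n : ℕ, 2 ≤ n →
        ∃ S₀ : ℕ, ∀ S : ℕ, S₀ ≤ S →
          ∀ (R R' : ℕ) (o : Fin n → Fin 4 × Fin 4) (x : Fin n → Zd4),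
            (∀ k, (o k).1 ≠ (o k).2) → 1 ≤ R' → R' ≤ R → (R' : ℝ) ≤ c₀ / m β →
            4 * R + 4 < 2 * S + 1 →
            (∀ k l, k ≠ l → ∃ μ : Fin 4, (2 * R + 1 : ℤ) < |x k μ - x l μ| ∧ |x k μ - x l μ| ≤ S) →
              let μ := wilsonMeasure (d := 4) (L := 2 * S + 1) r.ρ β
              |∫ U, ∏ k, (torusPlaquette r (2 * S + 1) (o k).1 (o k).2 (x k) U -
                  ∫ V, torusPlaquette r (2 * S + 1) (o k).1 (o k).2 (x k) V ∂μ) ∂μ|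
                ≤ (C * (n : ℝ) ^ γ * Real.sqrt (rpSquare r β S R')) ^ n

/-- The influence profile is non-negative (it is a real `Lᵖ` norm). -/
theorem influence_nonneg {G : Type} [Group G] [TopologicalSpace G] [IsTopologicalGroup G]
    [CompactSpace G] [MeasurableSpace G] [BorelSpace G] (r : LatticeRep G) (β : ℝ) (S R : ℕ)
    (x : Zd4) (i j : Fin 4) (p : ℝ≥0∞) : 0 ≤ influence r β S R x i j p :=
  ENNReal.toReal_nonneg

/-- **Glue (proved): (T) ∧ (M), (WI₂), (WIₙ) ⇒ Gaussian domination.** Chain, factor by factor: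
`|⟨∏ δp⟩| ≤ ∏ I_n(R) ≤ ∏ I_n(R') ≤ ∏ C n^γ I₂(R') ≤ ∏ C n^γ C' √A(R')`. -/
theorem gaussianDomination_of (hT : TelescopingBound ∧ InfluenceAntitone)
    (h₂ : CornerFreeInfluence) (hₙ : InfluenceReverseHolder) : GaussianDomination := by
  intro G _ _ _ _ _ _ hG r β₁ C₁ c₂ m hgap c₀ hc₀
  obtain ⟨C₂, β₂, h₂'⟩ := h₂ G hG r β₁ C₁ c₂ m hgap c₀ hc₀
  obtain ⟨Cₙ, βₙ, γ, hₙ'⟩ := hₙ G hG r β₁ C₁ c₂ m hgap c₀ hc₀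
  refine ⟨max Cₙ 0 * max C₂ 0, max β₂ βₙ, γ, fun β hβ n hn => ?_⟩
  obtain ⟨S₂, hS₂⟩ := h₂' β (le_trans (le_max_left _ _) hβ)
  obtain ⟨Sₙ, hSₙ⟩ := hₙ' β (le_trans (le_max_right _ _) hβ) n hn
  refine ⟨max S₂ Sₙ, fun S hS R R' o x ho hR' hR'R hR'c hfit hsep => ?_⟩
  have hS₂' : S₂ ≤ S := le_trans (le_max_left _ _) hS
  have hSₙ' : Sₙ ≤ S := le_trans (le_max_right _ _) hS
  -- (T): product of Lⁿ influences at radius R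
  have step1 := hT.1 G r β S R n o x ho hfit hsep
  -- factor-by-factor chain
  have hp : (1 : ℝ≥0∞) ≤ (n : ℝ≥0∞) := by exact_mod_cast (le_trans (by norm_num) hn : 1 ≤ n)
  have hfitR : 2 * R + 2 < 2 * S + 1 := by omega
  have hfactor : ∀ k : Fin n,
      influence r β S R (x k) (o k).1 (o k).2 n ≤
        max Cₙ 0 * max C₂ 0 * (n : ℝ) ^ γ * Real.sqrt (rpSquare r β S R') := by
    intro k
    have hij : (o k).1 ≠ (o k).2 := ho k
    have a1 : influence r β S R (x k) (o k).1 (o k).2 n ≤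
        influence r β S R' (x k) (o k).1 (o k).2 n :=
      hT.2 G r β S (x k) (o k).1 (o k).2 n hp R R' hR'R hfitR
    have a2 : influence r β S R' (x k) (o k).1 (o k).2 n ≤
        Cₙ * (n : ℝ) ^ γ * influence r β S R' (x k) (o k).1 (o k).2 2 :=
      hSₙ S hSₙ' R' hR' hR'c (x k) (o k).1 (o k).2 hij
    have a3 : influence r β S R' (x k) (o k).1 (o k).2 2 ≤ C₂ * Real.sqrt (rpSquare r β S R') :=
      hS₂ S hS₂' R' hR' hR'c (x k) (o k).1 (o k).2 hij
    have hI2 : 0 ≤ influence r β S R' (x k) (o k).1 (o k).2 2 := influence_nonneg _ _ _ _ _ _ _ _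
    have hsq : 0 ≤ Real.sqrt (rpSquare r β S R') := Real.sqrt_nonneg _
    have hnγ : 0 ≤ (n : ℝ) ^ γ := by positivity
    have a2' : influence r β S R' (x k) (o k).1 (o k).2 n ≤
        max Cₙ 0 * (n : ℝ) ^ γ * influence r β S R' (x k) (o k).1 (o k).2 2 := by
      refine le_trans a2 ?_
      have : Cₙ * (n : ℝ) ^ γ ≤ max Cₙ 0 * (n : ℝ) ^ γ :=
        mul_le_mul_of_nonneg_right (le_max_left _ _) hnγ
      exact mul_le_mul_of_nonneg_right this hI2
    have a3' : influence r β S R' (x k) (o k).1 (o k).2 2 ≤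
        max C₂ 0 * Real.sqrt (rpSquare r β S R') := by
      refine le_trans a3 ?_
      exact mul_le_mul_of_nonneg_right (le_max_left _ _) hsq
    have hC : 0 ≤ max Cₙ 0 * (n : ℝ) ^ γ := mul_nonneg (le_max_right _ _) hnγ
    calc influence r β S R (x k) (o k).1 (o k).2 n
        ≤ influence r β S R' (x k) (o k).1 (o k).2 n := a1
      _ ≤ max Cₙ 0 * (n : ℝ) ^ γ * influence r β S R' (x k) (o k).1 (o k).2 2 := a2'
      _ ≤ max Cₙ 0 * (n : ℝ) ^ γ * (max C₂ 0 * Real.sqrt (rpSquare r β S R')) :=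
          mul_le_mul_of_nonneg_left a3' hC
      _ = max Cₙ 0 * max C₂ 0 * (n : ℝ) ^ γ * Real.sqrt (rpSquare r β S R') := by ring
  have step2 : ∏ k : Fin n, influence r β S R (x k) (o k).1 (o k).2 n ≤
      ∏ _k : Fin n, (max Cₙ 0 * max C₂ 0 * (n : ℝ) ^ γ * Real.sqrt (rpSquare r β S R')) :=
    Finset.prod_le_prod (fun k _ => influence_nonneg _ _ _ _ _ _ _ _) (fun k _ => hfactor k)
  rw [Finset.prod_const, Finset.card_univ, Fintype.card_fin] at step2
  exact le_trans step1 step2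

/-! ## 6. The one-field form of the crux and its (vendored, checked) reduction to the crux -/

section OneField

variable {G : Type} [Group G] [TopologicalSpace G] [IsTopologicalGroup G] [CompactSpace G]
  [MeasurableSpace G] [BorelSpace G]

/-- **The one-field clauses** for one gauge group and one witness `(r, sch, S₁)`: ONE scalar
field (the curvature) with E0 (normalisation, hermiticity), E0′, E2, E3, E4, translation and
proper-hypercubic invariance on `⁰𝒮`; convergence of the renormalised curvature `n`-point
functions along `sch`; non-triviality; non-Gaussianity; a continuum gap and the uniform lattice
gap (verbatim the clauses of `HypercubicLimit` restricted to the constant label string —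
`Disproof.lean` §4 `Clauses₁`; verbatim the right-hand side of the landed
`Negative.OneFieldReduction.hypercubicLimit_iff_oneField`). -/
def OneFieldWitness (r : LatticeRep G) (sch : SpeciesScheme (YMSpecies G))
    (S₁ : SchwingerFamily E4) : Prop :=
  (S₁.toLabelled.IsNormalized ∧ S₁.toLabelled.IsHermitian ∧ S₁.toLabelled.HasLinearGrowth ∧
    S₁.toLabelled.IsReflectionPositive ∧ S₁.toLabelled.IsSymmetric ∧
    S₁.toLabelled.HasClusterProperty ∧
    (∀ (n : ℕ) (k : Fin n → Unit) (a : E4) (F : 𝓢((Fin n → E4), ℂ)), IsOffDiagonal F →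
      S₁.toLabelled n k (translateMulti a F) = S₁.toLabelled n k F) ∧
    (∀ (n : ℕ) (k : Fin n → Unit) (R : E4 ≃ₗᵢ[ℝ] E4),
      LinearMap.det (R.toLinearEquiv : E4 →ₗ[ℝ] E4) = 1 →
      (∀ i : Fin 4, ∃ j : Fin 4, R (EuclideanSpace.single i 1) = EuclideanSpace.single j 1 ∨
        R (EuclideanSpace.single i 1) = -EuclideanSpace.single j 1) →
      ∀ F : 𝓢((Fin n → E4), ℂ), IsOffDiagonal F →
        S₁.toLabelled n k (linActMulti R F) = S₁.toLabelled n k F)) ∧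
  (∀ (n : ℕ), n ≠ 0 → ∀ (f : Fin n → 𝓢(E4, ℝ)) (F : 𝓢((Fin n → E4), ℂ)),
    IsTensorOf F (fun i => ofRealTest (f i)) → IsOffDiagonal F →
      Tendsto (fun k : ℕ =>
        ((latticeSchwinger r.ρ sch (fun s => s.F) k n (fun _ => r.curvature) f : ℝ) : ℂ))
        atTop (𝓝 (S₁ n F))) ∧
  (∃ (F₁ G₁ : 𝓢((Fin 1 → E4), ℂ)) (H₁ : 𝓢((Fin (1 + 1) → E4), ℂ)),
    IsTimeOrdered F₁ ∧ IsTimeOrdered G₁ ∧ IsAppendTensorOf H₁ (osAdjoint F₁) G₁ ∧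
      S₁ (1 + 1) H₁ ≠ S₁ 1 (osAdjoint F₁) * S₁ 1 G₁) ∧
  (∃ (f g h : 𝓢(E4, ℂ)) (Ffgh : 𝓢((Fin 3 → E4), ℂ)) (Fgh Ffh Ffg : 𝓢((Fin 2 → E4), ℂ))
      (Ff Fg Fh : 𝓢((Fin 1 → E4), ℂ)),
    IsTensorOf Ffgh ![f, g, h] ∧ IsOffDiagonal Ffgh ∧ IsTensorOf Fgh ![g, h] ∧
    IsTensorOf Ffh ![f, h] ∧ IsTensorOf Ffg ![f, g] ∧ IsTensorOf Ff ![f] ∧ IsTensorOf Fg ![g] ∧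
    IsTensorOf Fh ![h] ∧
      S₁ 3 Ffgh - S₁ 1 Ff * S₁ 2 Fgh - S₁ 1 Fg * S₁ 2 Ffh - S₁ 1 Fh * S₁ 2 Ffg +
        2 * (S₁ 1 Ff * S₁ 1 Fg * S₁ 1 Fh) ≠ 0) ∧
  (∃ Δ : ℝ, 0 < Δ ∧ S₁.toLabelled.HasMassGap Δ ∧ HasLatticeMassGap r sch Δ)

end OneField

/-- **The one-field form of the crux** (`Negative/OneFieldReduction.lean`:
`hypercubicLimit_iff_oneField` says `HypercubicLimit ↔` this, clause by clause): every compact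
simple Lie group admits `(r, sch, S₁)` with `OneFieldWitness r sch S₁`. -/
def OneFieldLimit : Prop :=
  ∀ (G : Type) [Group G] [TopologicalSpace G] [IsTopologicalGroup G] [CompactSpace G],
    IsCompactSimpleLieGroup G →
      letI : MeasurableSpace G := borel G
      haveI : BorelSpace G := ⟨rfl⟩
      ∃ (r : LatticeRep G) (sch : SpeciesScheme (YMSpecies G)) (S₁ : SchwingerFamily E4),
        OneFieldWitness r sch S₁

open Summit.QuantumFields.YangMills.Theorems.HypercubicLimit.Negative in
/-- **One field suffices** (checked against the LANDED tree theorem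
`Negative.OneFieldReduction.hypercubicLimit_iff_oneField`, `Disproof.lean` §4; gen 2 — nothing
vendored any more): the one-field form implies the crux BY NAME — renormalise every other species
to zero (`onlySpecies`) and extend the one-field family by zero (`extendByZero`).
`OneFieldWitness` is the tree theorem's right-hand side verbatim (`S₁.toLabelled n k = S₁ n`
definitionally), so the reduction is one application. -/
theorem hypercubicLimit_of_oneFieldLimit (h : OneFieldLimit) :
    Summit.QuantumFields.YangMills.Theses.PencilRigidity.HypercubicLimit :=
  hypercubicLimit_iff_oneField.mpr fun G _ _ _ _ hG => h G hG

/-! ## 7. The registered stubs and the composition -/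

/-- **Locality of the conditional mean (Markov property of the torus Wilson state)** — the
`Prop` behind the registered stub `stub_condMeanLocality` (reshape 2, lead): for every cube
radius `R` and base site `x`, the conditional expectation of the centred plaquette at `x` given
the links NOT interior to `Q_R(x)` has a version measurable with respect to the links interior to
`Q_{R+1}(x)` (interior ∪ shell).  Route: the torus Wilson state is the full-volume Gibbs
distribution of the plaquette potential on the finite link set (tree `gibbsSpecOfPotential`,
`isSpecification_gibbsSpecOfPotential`), hence a DLR state, so the specification kernel is a
version of the conditional expectation (`IsGibbsMeasure.integral_ae_eq_condExp`), and the kernel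
reads only links of plaquettes touching `Q_R(x)`, all inside `Q_{R+1}(x)` (no side condition on
`R` versus `S` is needed: everything is stated through images under `torusEdge`). -/
def CondMeanLocality : Prop :=
  ∀ (G : Type) [Group G] [TopologicalSpace G] [IsTopologicalGroup G] [CompactSpace G]
        [MeasurableSpace G] [BorelSpace G] (r : LatticeRep G) (β : ℝ) (S R : ℕ)
        (x : Literature.Probability.LatticeModels.Site 4) (i j : Fin 4),
      ∃ g : GaugeConfig 4 (2 * S + 1) G → ℝ,
        StronglyMeasurable[(cylinderEvents
            (torusEdge (2 * S + 1) ''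
              {e : Literature.MathematicalPhysics.QuantumLattice.ZdEdge 4 |
                (∀ ν, |e.1 ν - x ν| ≤ ((R + 1 : ℕ) : ℤ)) ∧
                ∀ ν, |e.1 ν + (if ν = e.2 then 1 else 0) - x ν| ≤ ((R + 1 : ℕ) : ℤ)}) :
            MeasurableSpace (GaugeConfig 4 (2 * S + 1) G))] g ∧
        g =ᵐ[(wilsonMeasure r.ρ β : Measure (GaugeConfig 4 (2 * S + 1) G))]
          (wilsonMeasure r.ρ β : Measure (GaugeConfig 4 (2 * S + 1) G))[fun U =>
              plaquetteObs r.ρ x i j (torusLift (2 * S + 1) U) -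
                ∫ V, plaquetteObs r.ρ x i j (torusLift (2 * S + 1) V)
                  ∂(wilsonMeasure r.ρ β : Measure (GaugeConfig 4 (2 * S + 1) G)) |
            (cylinderEvents
              (torusEdge (2 * S + 1) ''
                {e : Literature.MathematicalPhysics.QuantumLattice.ZdEdge 4 |
                  (∀ ν, |e.1 ν - x ν| ≤ R) ∧
                  ∀ ν, |e.1 ν + (if ν = e.2 then 1 else 0) - x ν| ≤ R})ᶜ :
              MeasurableSpace (GaugeConfig 4 (2 * S + 1) G))]

/-- **stub_condMeanLocality** (registered; provable now, M-sized; tree vocabulary only, no `:=`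
inside the statement).  See `CondMeanLocality` for the route. -/
theorem stub_condMeanLocality :
    ∀ (G : Type) [Group G] [TopologicalSpace G] [IsTopologicalGroup G] [CompactSpace G]
        [MeasurableSpace G] [BorelSpace G] (r : LatticeRep G) (β : ℝ) (S R : ℕ)
        (x : Literature.Probability.LatticeModels.Site 4) (i j : Fin 4),
      ∃ g : GaugeConfig 4 (2 * S + 1) G → ℝ,
        StronglyMeasurable[(cylinderEvents
            (torusEdge (2 * S + 1) ''
              {e : Literature.MathematicalPhysics.QuantumLattice.ZdEdge 4 |
                (∀ ν, |e.1 ν - x ν| ≤ ((R + 1 : ℕ) : ℤ)) ∧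
                ∀ ν, |e.1 ν + (if ν = e.2 then 1 else 0) - x ν| ≤ ((R + 1 : ℕ) : ℤ)}) :
            MeasurableSpace (GaugeConfig 4 (2 * S + 1) G))] g ∧
        g =ᵐ[(wilsonMeasure r.ρ β : Measure (GaugeConfig 4 (2 * S + 1) G))]
          (wilsonMeasure r.ρ β : Measure (GaugeConfig 4 (2 * S + 1) G))[fun U =>
              plaquetteObs r.ρ x i j (torusLift (2 * S + 1) U) -
                ∫ V, plaquetteObs r.ρ x i j (torusLift (2 * S + 1) V)
                  ∂(wilsonMeasure r.ρ β : Measure (GaugeConfig 4 (2 * S + 1) G)) |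
            (cylinderEvents
              (torusEdge (2 * S + 1) ''
                {e : Literature.MathematicalPhysics.QuantumLattice.ZdEdge 4 |
                  (∀ ν, |e.1 ν - x ν| ≤ R) ∧
                  ∀ ν, |e.1 ν + (if ν = e.2 then 1 else 0) - x ν| ≤ R})ᶜ :
              MeasurableSpace (GaugeConfig 4 (2 * S + 1) G))] := by
  sorry

/-- **stub_telescoping** (registered; provable now, M-sized): LOCALITY ⇒ (T) ∧ (M), in tree
vocabulary only.  (T): tower + pull-out (`condExp_mul_of_stronglyMeasurable_left`) site by site,
using the locality versions `g_k` of the conditional means (measurable inside `Q_{R+1}(x_k)`, which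
misses the interior of every other `Q_R(x_l)` on the torus exactly under the typed separation
`2R+1 < |x_k^μ - x_l^μ| ≤ S`, `4R+4 < 2S+1`), then the generalised Hölder inequality
(`lintegral_prod_norm_pow_le` with exponents `1/n`); the influences are taken AT the base points
(no translation invariance).  (M): `cylinderEvents` is monotone, tower
(`condExp_condExp_of_le`) and `Lᵖ`-contraction (`eLpNorm_condExp_le_eLpNorm`), finiteness from the
boundedness of the plaquette (`abs_plaquetteObs_le_holds`) on a probability space. -/
theorem stub_telescoping :
    (∀ (G : Type) [Group G] [TopologicalSpace G] [IsTopologicalGroup G] [CompactSpace G]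
        [MeasurableSpace G] [BorelSpace G] (r : LatticeRep G) (β : ℝ) (S R : ℕ)
        (x : Literature.Probability.LatticeModels.Site 4) (i j : Fin 4),
      ∃ g : GaugeConfig 4 (2 * S + 1) G → ℝ,
        StronglyMeasurable[(cylinderEvents
            (torusEdge (2 * S + 1) ''
              {e : Literature.MathematicalPhysics.QuantumLattice.ZdEdge 4 |
                (∀ ν, |e.1 ν - x ν| ≤ ((R + 1 : ℕ) : ℤ)) ∧
                ∀ ν, |e.1 ν + (if ν = e.2 then 1 else 0) - x ν| ≤ ((R + 1 : ℕ) : ℤ)}) :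
            MeasurableSpace (GaugeConfig 4 (2 * S + 1) G))] g ∧
        g =ᵐ[(wilsonMeasure r.ρ β : Measure (GaugeConfig 4 (2 * S + 1) G))]
          (wilsonMeasure r.ρ β : Measure (GaugeConfig 4 (2 * S + 1) G))[fun U =>
              plaquetteObs r.ρ x i j (torusLift (2 * S + 1) U) -
                ∫ V, plaquetteObs r.ρ x i j (torusLift (2 * S + 1) V)
                  ∂(wilsonMeasure r.ρ β : Measure (GaugeConfig 4 (2 * S + 1) G)) |
            (cylinderEvents
              (torusEdge (2 * S + 1) ''
                {e : Literature.MathematicalPhysics.QuantumLattice.ZdEdge 4 |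
                  (∀ ν, |e.1 ν - x ν| ≤ R) ∧
                  ∀ ν, |e.1 ν + (if ν = e.2 then 1 else 0) - x ν| ≤ R})ᶜ :
              MeasurableSpace (GaugeConfig 4 (2 * S + 1) G))]) →
    (∀ (G : Type) [Group G] [TopologicalSpace G] [IsTopologicalGroup G] [CompactSpace G]
        [MeasurableSpace G] [BorelSpace G] (r : LatticeRep G) (β : ℝ) (S R n : ℕ)
        (o : Fin n → Fin 4 × Fin 4) (x : Fin n → Literature.Probability.LatticeModels.Site 4),
      (∀ k, (o k).1 ≠ (o k).2) →
      4 * R + 4 < 2 * S + 1 →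
      (∀ k l, k ≠ l → ∃ μ : Fin 4, (2 * R + 1 : ℤ) < |x k μ - x l μ| ∧ |x k μ - x l μ| ≤ S) →
        |∫ U, ∏ k, (plaquetteObs r.ρ (x k) (o k).1 (o k).2 (torusLift (2 * S + 1) U) -
              ∫ V, plaquetteObs r.ρ (x k) (o k).1 (o k).2 (torusLift (2 * S + 1) V)
                ∂(wilsonMeasure r.ρ β : Measure (GaugeConfig 4 (2 * S + 1) G)))
            ∂(wilsonMeasure r.ρ β : Measure (GaugeConfig 4 (2 * S + 1) G))| ≤
          ∏ k, (eLpNorm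
            ((wilsonMeasure r.ρ β : Measure (GaugeConfig 4 (2 * S + 1) G))[fun U =>
                plaquetteObs r.ρ (x k) (o k).1 (o k).2 (torusLift (2 * S + 1) U) -
                  ∫ V, plaquetteObs r.ρ (x k) (o k).1 (o k).2 (torusLift (2 * S + 1) V)
                    ∂(wilsonMeasure r.ρ β : Measure (GaugeConfig 4 (2 * S + 1) G)) |
              (cylinderEvents
                (torusEdge (2 * S + 1) ''
                  {e : Literature.MathematicalPhysics.QuantumLattice.ZdEdge 4 |
                    (∀ ν, |e.1 ν - (x k) ν| ≤ R) ∧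
                    ∀ ν, |e.1 ν + (if ν = e.2 then 1 else 0) - (x k) ν| ≤ R})ᶜ :
                MeasurableSpace (GaugeConfig 4 (2 * S + 1) G))])
            (n : ℝ≥0∞) (wilsonMeasure r.ρ β : Measure (GaugeConfig 4 (2 * S + 1) G))).toReal) ∧
    (∀ (G : Type) [Group G] [TopologicalSpace G] [IsTopologicalGroup G] [CompactSpace G]
        [MeasurableSpace G] [BorelSpace G] (r : LatticeRep G) (β : ℝ) (S : ℕ)
        (x : Literature.Probability.LatticeModels.Site 4) (i j : Fin 4)
        (p : ℝ≥0∞), 1 ≤ p → ∀ R R' : ℕ, R' ≤ R → 2 * R + 2 < 2 * S + 1 →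
        (eLpNorm
          ((wilsonMeasure r.ρ β : Measure (GaugeConfig 4 (2 * S + 1) G))[fun U =>
              plaquetteObs r.ρ x i j (torusLift (2 * S + 1) U) -
                ∫ V, plaquetteObs r.ρ x i j (torusLift (2 * S + 1) V)
                  ∂(wilsonMeasure r.ρ β : Measure (GaugeConfig 4 (2 * S + 1) G)) |
            (cylinderEvents
              (torusEdge (2 * S + 1) ''
                {e : Literature.MathematicalPhysics.QuantumLattice.ZdEdge 4 |
                  (∀ ν, |e.1 ν - x ν| ≤ R) ∧
                  ∀ ν, |e.1 ν + (if ν = e.2 then 1 else 0) - x ν| ≤ R})ᶜ :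
              MeasurableSpace (GaugeConfig 4 (2 * S + 1) G))])
          p (wilsonMeasure r.ρ β : Measure (GaugeConfig 4 (2 * S + 1) G))).toReal ≤
        (eLpNorm
          ((wilsonMeasure r.ρ β : Measure (GaugeConfig 4 (2 * S + 1) G))[fun U =>
              plaquetteObs r.ρ x i j (torusLift (2 * S + 1) U) -
                ∫ V, plaquetteObs r.ρ x i j (torusLift (2 * S + 1) V)
                  ∂(wilsonMeasure r.ρ β : Measure (GaugeConfig 4 (2 * S + 1) G)) |
            (cylinderEvents
              (torusEdge (2 * S + 1) ''
                {e : Literature.MathematicalPhysics.QuantumLattice.ZdEdge 4 |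
                  (∀ ν, |e.1 ν - x ν| ≤ R') ∧
                  ∀ ν, |e.1 ν + (if ν = e.2 then 1 else 0) - x ν| ≤ R'})ᶜ :
              MeasurableSpace (GaugeConfig 4 (2 * S + 1) G))])
          p (wilsonMeasure r.ρ β : Measure (GaugeConfig 4 (2 * S + 1) G))).toReal) := by
  sorry

/-- The two registered stubs give `TelescopingBound ∧ InfluenceAntitone`, definitionally (the
line's objects `torusPlaquette`, `influence`, `exterior`, `cubeEdgesT`, `cubeEdges` unfold by
`δ`/`ζ`-reduction; no rewriting). -/
theorem telescoping_of_stubs : TelescopingBound ∧ InfluenceAntitone :=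
  stub_telescoping stub_condMeanLocality

/-- **stub (L′)** — the imported one-scale lattice gap with `ξ → ∞` (IR open problem, shared). -/
theorem stub_latticeGapInput : LatticeGapInput := by
  sorry

/-- **stub (WI) = (WI₂) ∧ (WIₙ)** — the INFLUENCE WINDOW (lead's stub, the bet; HARDEST):
corner-free `L²` influence against the half-space RP anchor, and influence reverse Hölder
`Lⁿ ≤ C n^γ L²`, both below `c₀ ξ`, at every base site with site-free constants (reshape 2 merges
the two window inequalities into one registered stub held by the lead; each conjunct keeps its
own `Prop` and its own falsifier). -/
theorem stub_influenceWindow : CornerFreeInfluence ∧ InfluenceReverseHolder := by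
  sorry

/-- **stub (W2)** — window regularity of the reference RP square (doubling, cone, floor). -/
theorem stub_windowRegularity : WindowRegularity := by
  sorry

/-- **stub (NG)** — the scale-free smeared `κ₃` floor (socket). -/
theorem stub_nonGaussianFloor : NonGaussianFloor := by
  sorry

/-- **stub (C) closure / transfer** `C⁺ ⇒` one-field form of the crux: along `β_k → ∞`,
`a_k := m(β_k)`, fast-growing `L_k`, centring `m_k := ⟨P⟩` and the RP normalisation
`c_k² := δ₀⁻⁸ / ⟨θΦ_k(F₀) · Φ_k(F₀)⟩`: (1) k-uniform E0′ on `⁰𝒮` from Gaussian domination +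
window regularity (dyadic decomposition in the distance to the diagonal, `6ⁿ` orientation
strings); (2) diagonal subsequence + Hahn–Banach ⇒ `Converges₁`; (3) OS inheritance: E0, E3,
hypercubic and `a_kℤ⁴`→`ℝ⁴` translation invariance by equicontinuity, E2 from lattice RP
(`wilsonExpectation_oddReflectionPositive`, the `P∘θ = P − ∇₀T` swap costs `O(a_k)`), E4 and
`HasMassGap 1` from the RP-spectral clause of the gap data, `HasLatticeMassGap r sch 1` verbatim
from the all-pairs clause; (4) `IsNontrivial` by construction of `c_k`, `IsNonGaussian` from the
`κ₃` floor.  Compactness + inheritance; no new idea, but L-sized. -/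
theorem stub_closure :
    LatticeGapInput → GaussianDomination → WindowRegularity → NonGaussianFloor → OneFieldLimit := by
  sorry

/-- **Composition (kernel-checked, no `sorry` of its own):** the seven stubs imply the crux
`PencilRigidity.HypercubicLimit` BY NAME.  Route: (T)+(M), (WI₂), (WIₙ) ⇒ Gaussian domination
(`gaussianDomination_of`); with (L′), (W2), (NG) the closure gives the one-field form; the
one-field reduction (`hypercubicLimit_of_oneFieldLimit` = one application of the landed
`Negative.OneFieldReduction.hypercubicLimit_iff_oneField`) gives the crux. -/
theorem HypercubicLimit_of :
    (TelescopingBound ∧ InfluenceAntitone) → LatticeGapInput → CornerFreeInfluence →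
      InfluenceReverseHolder → WindowRegularity → NonGaussianFloor →
      (LatticeGapInput → GaussianDomination → WindowRegularity → NonGaussianFloor → OneFieldLimit) →
        Summit.QuantumFields.YangMills.Theses.PencilRigidity.HypercubicLimit :=
  fun hT hL h₂ hₙ hW hNG hC =>
    hypercubicLimit_of_oneFieldLimit (hC hL (gaussianDomination_of hT h₂ hₙ) hW hNG)

/-- **Registered target of the skeleton** (checker convention `<Crux>_proof`): the crux in the
item's primary route file `CoincidenceRotationBootstrap` (stmt-QuantumFields-8646), obtained from
the seven stubs through `HypercubicLimit_of`.  The decl is shared VERBATIM by the three routes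
`PencilRigidity` / `CoincidenceRotationBootstrap` / `MirrorModularBoosts`, so the three constants
are definitionally equal and this term (of type `PencilRigidity.HypercubicLimit`) checks against
each of them.  No `sorry` of its own; the sorries live in the `stub_*` it consumes. -/
theorem HypercubicLimit_proof :
    Summit.QuantumFields.YangMills.Theses.CoincidenceRotationBootstrap.HypercubicLimit :=
  HypercubicLimit_of telescoping_of_stubs stub_latticeGapInput stub_influenceWindow.1
    stub_influenceWindow.2 stub_windowRegularity stub_nonGaussianFloor stub_closure

/-- Same term against the third route's copy of the crux (`MirrorModularBoosts`). -/
theorem HypercubicLimit_proof_mirrorModularBoosts :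
    Summit.QuantumFields.YangMills.Theses.MirrorModularBoosts.HypercubicLimit :=
  HypercubicLimit_proof

/-- … and against `PencilRigidity`'s copy (the payload's `route_id`). -/
theorem HypercubicLimit_proof_pencilRigidity :
    Summit.QuantumFields.YangMills.Theses.PencilRigidity.HypercubicLimit :=
  HypercubicLimit_proof

end Summit.QuantumFields.YangMills.Cruxes.HypercubicLimit.ConditionalMeanTelescoping

end
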